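import Summits.MatrixMultiplication.OmegaCensus.STPP222IcosetWSearchSelect

/-!
# ω-census, icoset class negatives at 2-rank four: semantics of the witness-model engine, V — SOUNDNESS of the search

HONEST FRAMING (pub-omega census; verbatim): lottery ticket; floor = certified bounds/negative ranges.
Census STRUCTURE bookkeeping (Q7, the involution-coset class), nothing about `ω`.

**`IcosetW.BSol.vrefute_sound`.**  Let `S` be a bit solution — frames `(sA_t, sB_t, sC_t)` of `𝔽₂⁴` independent with frame `0`
standard `(1,2,4)`, 4-bit offsets `p_t, q_t` — for `K ≤ 8` triples, and `TD` a list of zero codes `64 i + 8 j + k` (indices `< K`) each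
RESCUED by `S`: some functional `u` lies on line `0` of triple `i`, line `1` of `j`, line `2` of `k` and has `u(p_i + q_j + p_k + q_k) = 1`.
Then `IcosetW.vrefute K TD = false`.  Proof: the invariant of `STPP222IcosetWSearchSelect.lean` holds at the root
(`tripInfo_sound`) and is preserved by the child taken along the TRUE witness of the selected zero (`select_spec`, `mem_candM`,
`addEq_sound` / `rowVal_eqRow`, `refresh_sound`), so no branch containing the truth is pruned and the search cannot return `true`.
Seat pub-omega-kernel-l4 (gen 20), 2026-08-27.
-/

namespace Summit.MatrixMultiplication.OmegaCensus

namespace IcosetW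

open IcosetH (getI snoc allN allN_true getI_eq_getD)

namespace BSol

variable {S : BSol}

/-- `child` unfolded when the equation is consistent (`addEq = 0 :: R'`). -/
theorem child_eq_of_addEq (K : ℕ) (rec : List ℕ → List ℕ → List ℕ → List ℕ → List ℕ → Bool) (PS PL TI RW TD : List ℕ)
    (z u : ℕ) {R' : List ℕ} (hadd : addEq RW (Nat.mul 8 K) (eqRow u (zi z) (zj z) (zk z)) = 0 :: R') :
    child K rec PS PL TI RW TD z u =
      (let PS1 := cnd (Nat.beq (zrep z) 0) PS (setI PS (Nat.sub (zrep z) 1) u)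
       let PL1 := setI PL (Nat.mul 3 (zi z)) (Nat.add (Nat.mul (getI PL (Nat.mul 3 (zi z))) 16) u)
       let PL2 := setI PL1 (Nat.add (Nat.mul 3 (zj z)) 1) (Nat.add (Nat.mul (getI PL1 (Nat.add (Nat.mul 3 (zj z)) 1)) 16) u)
       let PL3 := setI PL2 (Nat.add (Nat.mul 3 (zk z)) 2) (Nat.add (Nat.mul (getI PL2 (Nat.add (Nat.mul 3 (zk z)) 2)) 16) u)
       refresh PS1 PL3 TI (zi z) fun PS2 TI2 => refresh PS2 PL3 TI2 (zj z) fun PS3 TI3 =>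
         refresh PS3 PL3 TI3 (zk z) fun PS4 TI4 => rec PS4 PL3 TI4 R' (removeI TD z)) := by
  unfold child; simp only [frc_eq, frcL_eq]; rw [hadd]; rfl

/-- Index arithmetic of the line slots. -/
theorem slot_ne (i j k : ℕ) : 3 * i ≠ 3 * j + 1 ∧ 3 * j + 1 ≠ 3 * k + 2 ∧ 3 * i ≠ 3 * k + 2 := by omega

/-- Appending a true witness to a line list keeps it on the line. -/
theorem onLine_append {X t u : ℕ} {pl : ℕ} (h : OnLine X (S.sA t) (S.sB t) (S.sC t) pl) (hu : u < 16)
    (hon : S.onL X t u = true) : OnLine X (S.sA t) (S.sB t) (S.sC t) (pl * 16 + u) := by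
  have h0 : u ≠ 0 := by
    unfold onL onLB at hon; simp only [Bool.and_eq_true, Bool.not_eq_true'] at hon; exact Nat.ne_of_beq_eq_false hon.1
  exact allDig_append h ⟨h0, hu, hon⟩ hu

/-- **The child along the true witness** continues with a state satisfying the full invariant. -/
theorem child_sound {K : ℕ} (hF : S.FramesOk K) {PS PL TI RW TD : List ℕ} (I : S.Inv K PS PL TI RW TD)
    (rec : List ℕ → List ℕ → List ℕ → List ℕ → List ℕ → Bool) {z u : ℕ} (hz : z ∈ TD) (hu : u < 16)
    (h0 : S.onL 0 (zi z) u = true) (h1 : S.onL 1 (zj z) u = true) (h2 : S.onL 2 (zk z) u = true)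
    (hev : ev u (S.off (zi z) (zj z) (zk z)) = true) :
    ∃ PS' PL' TI' RW', child K rec PS PL TI RW TD z u = rec PS' PL' TI' RW' (removeI TD z) ∧
      S.Inv K PS' PL' TI' RW' (removeI TD z) := by
  obtain ⟨hi, hj, hk, -⟩ := I.zeros z hz
  have hpq : ∀ t, t < K → S.p t < 16 ∧ S.q t < 16 := fun t ht => ⟨(hF t ht).2.2.2.1, (hF t ht).2.2.2.2.1⟩
  -- the equation
  obtain ⟨hval, hrow⟩ := S.rowVal_eqRow (K := K) hu hi hj hk hpq
  rw [hev] at hval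
  obtain ⟨R', hadd, hR'⟩ := S.addEq_sound I.rows hrow hval
  have hce := child_eq_of_addEq K rec PS PL TI RW TD z u (R' := R') hadd
  simp only [Nat.add_eq, Nat.mul_eq, Nat.sub_eq] at hce
  rw [hce]
  -- the three line lists
  set PL1 := setI PL (3 * zi z) (getI PL (3 * zi z) * 16 + u) with hPL1
  set PL2 := setI PL1 (3 * zj z + 1) (getI PL1 (3 * zj z + 1) * 16 + u) with hPL2
  set PL3 := setI PL2 (3 * zk z + 2) (getI PL2 (3 * zk z + 2) * 16 + u) with hPL3
  set PS1 := cnd (Nat.beq (zrep z) 0) PS (setI PS (zrep z - 1) u) with hPS1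
  have lPL1 : PL1.length = 3 * K := by rw [hPL1, length_setI, I.lenPL]
  have lPL2 : PL2.length = 3 * K := by rw [hPL2, length_setI, lPL1]
  have lPL3 : PL3.length = 3 * K := by rw [hPL3, length_setI, lPL2]
  obtain ⟨n1, n2, n3⟩ := slot_ne (zi z) (zj z) (zk z)
  have gPL3 : ∀ m, m < 3 * K → getI PL3 m =
      if m = 3 * zk z + 2 then getI PL (3 * zk z + 2) * 16 + u else if m = 3 * zj z + 1 then getI PL (3 * zj z + 1) * 16 + u
      else if m = 3 * zi z then getI PL (3 * zi z) * 16 + u else getI PL m := by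
    intro m hm
    have e3 : getI PL3 m = if m = 3 * zk z + 2 then getI PL2 (3 * zk z + 2) * 16 + u else getI PL2 m := by
      rw [hPL3, getI_setI _ _ _ _ (by rw [lPL2]; omega)]
    have e2 : ∀ m', m' < 3 * K → getI PL2 m' = if m' = 3 * zj z + 1 then getI PL1 (3 * zj z + 1) * 16 + u else getI PL1 m' :=
      fun m' _ => by rw [hPL2, getI_setI _ _ _ _ (by rw [lPL1]; omega)]
    have e1 : ∀ m', m' < 3 * K → getI PL1 m' = if m' = 3 * zi z then getI PL (3 * zi z) * 16 + u else getI PL m' :=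
      fun m' _ => by rw [hPL1, getI_setI _ _ _ _ (by rw [I.lenPL]; omega)]
    rw [e3]
    split_ifs with c3 c2 c1
    · rw [e2 _ (by omega), if_neg (by omega), e1 _ (by omega), if_neg (by omega)]
    · rw [e2 _ hm, if_pos c2, e1 _ (by omega), if_neg (by omega)]
    · rw [e2 _ hm, if_neg c2, e1 _ hm, if_pos c1]
    · rw [e2 _ hm, if_neg c2, e1 _ hm, if_neg c1]
  have hlines3 : ∀ t, t < K → ∀ X, X < 3 → OnLine X (S.sA t) (S.sB t) (S.sC t) (getI PL3 (3 * t + X)) := by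
    intro t ht X hX
    rw [gPL3 _ (by omega)]
    split_ifs with c3 c2 c1
    · obtain ⟨rfl, rfl⟩ : t = zk z ∧ X = 2 := by omega
      exact onLine_append (I.lines _ hk 2 (by norm_num)) hu h2
    · obtain ⟨rfl, rfl⟩ : t = zj z ∧ X = 1 := by omega
      exact onLine_append (I.lines _ hj 1 (by norm_num)) hu h1
    · obtain ⟨rfl, rfl⟩ : t = zi z ∧ X = 0 := by omega
      simpa using onLine_append (I.lines _ hi 0 (by norm_num)) hu h0
    · exact I.lines t ht X hX
  -- the recorded ψ
  have lPS1 : PS1.length = K := by rw [hPS1, cnd_eq_ite]; split_ifs <;> simp [length_setI, I.lenPS]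
  have hpsi1 : ∀ t, t < K → getI PS1 t = 0 ∨ getI PS1 t = S.ψ t := by
    intro t ht
    rw [hPS1, cnd_eq_ite]
    split_ifs with hr
    · exact I.psi t ht
    · have hr' : zrep z ≠ 0 := Nat.ne_of_beq_eq_false (Bool.eq_false_iff.2 hr)
      rcases zrep_cases z with hz0 | ⟨hjk, hzr⟩ | ⟨-, hij, hzr⟩
      · exact absurd hz0 hr'
      · rw [hzr, Nat.add_sub_cancel, getI_setI _ _ _ _ (by rw [I.lenPS]; exact hj)]
        split_ifs with htr
        · right; subst htr
          exact eq_ψ_of_two_lines hF hj hu (by norm_num) (by norm_num) (by norm_num) h1 (hjk ▸ h2)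
        · exact I.psi t ht
      · rw [hzr, Nat.add_sub_cancel, getI_setI _ _ _ _ (by rw [I.lenPS]; exact hi)]
        split_ifs with htr
        · right; subst htr
          rcases hij with hij | hik
          · exact eq_ψ_of_two_lines hF hi hu (by norm_num) (by norm_num) (by norm_num) h0 (hij ▸ h1)
          · exact eq_ψ_of_two_lines hF hi hu (by norm_num) (by norm_num) (by norm_num) h0 (hik ▸ h2)
        · exact I.psi t ht
  -- three refreshes
  have I1 : S.InvT K (fun s => s ≠ zi z ∧ s ≠ zj z ∧ s ≠ zk z) PS1 PL3 TI :=
    ⟨lPS1, lPL3, I.lenTI, hpsi1, hlines3, fun s hs _ => I.feas s hs, fun s hs _ => I.adm s hs⟩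
  obtain ⟨PS2, TI2, e2, I2⟩ := refresh_sound hF I1 hi (fun PS2 TI2 => refresh PS2 PL3 TI2 (zj z)
    fun PS3 TI3 => refresh PS3 PL3 TI3 (zk z) fun PS4 TI4 => rec PS4 PL3 TI4 R' (removeI TD z))
  obtain ⟨PS3, TI3, e3, I3⟩ := refresh_sound hF I2 hj (fun PS3 TI3 => refresh PS3 PL3 TI3 (zk z)
    fun PS4 TI4 => rec PS4 PL3 TI4 R' (removeI TD z))
  obtain ⟨PS4, TI4, e4, I4⟩ := refresh_sound hF I3 hk (fun PS4 TI4 => rec PS4 PL3 TI4 R' (removeI TD z))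
  have hfin : (refresh PS1 PL3 TI (zi z) fun PS2 TI2 => refresh PS2 PL3 TI2 (zj z) fun PS3 TI3 =>
      refresh PS3 PL3 TI3 (zk z) fun PS4 TI4 => rec PS4 PL3 TI4 R' (removeI TD z)) = rec PS4 PL3 TI4 R' (removeI TD z) := by
    rw [e2]; show refresh PS2 PL3 TI2 (zj z) _ = _; rw [e3]; show refresh PS3 PL3 TI3 (zk z) _ = _; rw [e4]
  refine ⟨PS4, PL3, TI4, R', hfin, ?_⟩
  have hall : ∀ s, s < K → ((s ≠ zi z ∧ s ≠ zj z ∧ s ≠ zk z) ∨ s = zi z) ∨ s = zj z ∨ s = zk z := fun s _ => by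
    by_cases a : s = zi z; · exact Or.inl (Or.inr a)
    by_cases b : s = zj z; · exact Or.inr (Or.inl b)
    by_cases c : s = zk z; · exact Or.inr (Or.inr c)
    exact Or.inl (Or.inl ⟨a, b, c⟩)
  exact ⟨I4.lenPS, I4.lenPL, I4.lenTI, I4.psi, I4.lines, fun s hs => I4.feas s hs (by rcases hall s hs with h | h | h <;> tauto),
    fun s hs => I4.adm s hs (by rcases hall s hs with h | h | h <;> tauto), hR',
    fun w hw => I.zeros w (mem_of_mem_removeI hw)⟩

/-! ## The search and the root -/

/-- `dfs` at fuel `+1` on a cons. -/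
theorem dfs_succ_cons (K fuel : ℕ) (PS PL TI RW : List ℕ) (z₀ : ℕ) (TD : List ℕ) :
    dfs K (fuel + 1) PS PL TI RW (z₀ :: TD) =
      cnd (Nat.beq (Nat.div (select TI (z₀ :: TD)) 268435456) 0) true
        (allBits16 (Nat.mod (select TI (z₀ :: TD)) 65536) fun u =>
          child K (dfs K fuel) PS PL TI RW (z₀ :: TD) (Nat.mod (Nat.div (select TI (z₀ :: TD)) 65536) 4096) u) := by
  show frc (select TI (z₀ :: TD)) (fun sel => cnd (Nat.beq (Nat.div sel 268435456) 0) true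
    (frc (Nat.mod (Nat.div sel 65536) 4096) fun z => allBits16 (Nat.mod sel 65536) fun u =>
      child K (dfs K fuel) PS PL TI RW (z₀ :: TD) z u)) = _
  simp only [frc_eq]

/-- **Soundness of the search**: along the truth no branch is pruned, so `dfs` never returns `true` on a state satisfying the
invariant. -/
theorem dfs_sound {K : ℕ} (hK : K ≤ 8) (hF : S.FramesOk K) :
    ∀ (fuel : ℕ) (PS PL TI RW TD : List ℕ), S.Inv K PS PL TI RW TD → dfs K fuel PS PL TI RW TD = true → False := by
  intro fuel
  induction fuel with
  | zero => intro PS PL TI RW TD _ h; exact absurd h (by show false ≠ true; decide)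
  | succ fuel ih =>
    intro PS PL TI RW TD I h
    cases TD with
    | nil => exact absurd h (by show false ≠ true; decide)
    | cons z₀ TD =>
      rw [dfs_succ_cons] at h
      obtain ⟨z, hz, hsel⟩ := select_spec TI z₀ TD
      obtain ⟨hi, hj, hk, u, hu, h0, h1, h2, hev⟩ := I.zeros z hz
      have hz4 : z < 4096 := by change z / 64 < K at hi; omega
      obtain ⟨f1, f2, f3⟩ := encS_fields TI hz4
      rw [hsel, f1, f2, f3] at h
      have hmem : Mem (candM TI z) u := mem_candM hF I hi hj hk hu h0 h1 h2
      have hc : popc16 (candM TI z) ≠ 0 := fun hc => ne_zero_of_mem hmem (popc16_eq_zero (candM_lt TI z) hc)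
      rw [beq_false_of_ne hc, cnd_false] at h
      have hch := allBits16_true h hu hmem
      obtain ⟨PS', PL', TI', RW', hce, I'⟩ := child_sound hF I (dfs K fuel) hz hu h0 h1 h2 hev
      rw [hce] at hch
      exact ih _ _ _ _ _ I' hch

/-- The root line lists of the standard frame lie on its lines. -/
theorem root_lines (h0 : S.sA 0 = 1 ∧ S.sB 0 = 2 ∧ S.sC 0 = 4) :
    OnLine 0 (S.sA 0) (S.sB 0) (S.sC 0) 76 ∧ OnLine 1 (S.sA 0) (S.sB 0) (S.sC 0) 25 ∧ OnLine 2 (S.sA 0) (S.sB 0) (S.sC 0) 42 := by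
  obtain ⟨ha, hb, hc⟩ := h0
  rw [ha, hb, hc]
  refine ⟨?_, ?_, ?_⟩
  · have := allDig_append (allDig_append (allDig_zero (fun v => v ≠ 0 ∧ v < 16 ∧ onLB 0 1 2 4 v = true))
      (u := 4) ⟨by decide, by decide, by decide⟩ (by decide)) (u := 12) ⟨by decide, by decide, by decide⟩ (by decide)
    exact this
  · have := allDig_append (allDig_append (allDig_zero (fun v => v ≠ 0 ∧ v < 16 ∧ onLB 1 1 2 4 v = true))
      (u := 1) ⟨by decide, by decide, by decide⟩ (by decide)) (u := 9) ⟨by decide, by decide, by decide⟩ (by decide)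
    exact this
  · have := allDig_append (allDig_append (allDig_zero (fun v => v ≠ 0 ∧ v < 16 ∧ onLB 2 1 2 4 v = true))
      (u := 2) ⟨by decide, by decide, by decide⟩ (by decide)) (u := 10) ⟨by decide, by decide, by decide⟩ (by decide)
    exact this

/-- The root refresh chain. -/
noncomputable def rootRec (PL0 : List ℕ) (base : List ℕ → List ℕ → Bool) (n : ℕ) (PS TI : List ℕ) : Bool :=
  @Nat.rec (fun _ => List ℕ → List ℕ → Bool) base (fun t ih PS TI => refresh PS PL0 TI t fun PS' TI' => ih PS' TI') n PS TI

/-- The root chain at `0`. -/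
theorem rootRec_zero (PL0 : List ℕ) (base : List ℕ → List ℕ → Bool) (PS TI : List ℕ) :
    rootRec PL0 base 0 PS TI = base PS TI := rfl

/-- One step of the root chain. -/
theorem rootRec_succ (PL0 : List ℕ) (base : List ℕ → List ℕ → Bool) (n : ℕ) (PS TI : List ℕ) :
    rootRec PL0 base (n + 1) PS TI = refresh PS PL0 TI n fun PS' TI' => rootRec PL0 base n PS' TI' := rfl

/-- `vrefute` unfolded. -/
theorem vrefute_eq (K : ℕ) (TD : List ℕ) : vrefute K TD =
    rootRec (76 :: 25 :: 42 :: zerosL (Nat.mul 3 (Nat.sub K 1)))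
      (fun PS TI => dfs K (Nat.add (lenL TD) 1) PS (76 :: 25 :: 42 :: zerosL (Nat.mul 3 (Nat.sub K 1))) TI [] TD) K
      (8 :: zerosL (Nat.sub K 1)) (zerosL K) := by
  unfold vrefute; simp only [frcL_eq]; rfl

/-- **SOUNDNESS OF `vrefute`.**  If the frames of `S` are independent 4-bit frames with frame `0` standard and every zero of `TD`
(indices `< K ≤ 8`) is rescued by `S`, the search does not refute `TD`. -/
theorem vrefute_sound (S : BSol) {K : ℕ} (hK : K ≤ 8) (hK0 : 0 < K) (hF : S.FramesOk K)
    (h0 : S.sA 0 = 1 ∧ S.sB 0 = 2 ∧ S.sC 0 = 4) {TD : List ℕ} (hTD : ∀ z ∈ TD, zi z < K ∧ zj z < K ∧ zk z < K ∧ S.Resc z) :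
    vrefute K TD = false := by
  cases hv : vrefute K TD with
  | false => rfl
  | true =>
    exfalso
    rw [vrefute_eq] at hv
    set PL0 := 76 :: 25 :: 42 :: zerosL (Nat.mul 3 (Nat.sub K 1)) with hPL0
    have lPL0 : PL0.length = 3 * K := by simp [hPL0]; omega
    have gPL0 : ∀ m, getI PL0 m = if m = 0 then 76 else if m = 1 then 25 else if m = 2 then 42 else 0 := by
      intro m
      rcases m with _ | _ | _ | m
      · rfl
      · rfl
      · rfl
      · simp [hPL0]
    obtain ⟨r0, r1, r2⟩ := root_lines h0
    have hlines0 : ∀ t, t < K → ∀ X, X < 3 → OnLine X (S.sA t) (S.sB t) (S.sC t) (getI PL0 (3 * t + X)) := by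
      intro t ht X hX
      rw [gPL0]
      rcases t with _ | t
      · interval_cases X
        · exact r0
        · exact r1
        · exact r2
      · rw [if_neg (by omega), if_neg (by omega), if_neg (by omega)]; exact allDig_zero _
    have hψ0 : S.ψ 0 = 8 := by unfold ψ; rw [h0.1, h0.2.1, h0.2.2]; decide
    -- the chain
    have chain : ∀ n, n ≤ K → ∀ PS TI, S.InvT K (fun s => n ≤ s) PS PL0 TI →
        rootRec PL0 (fun PS TI => dfs K (Nat.add (lenL TD) 1) PS PL0 TI [] TD) n PS TI = true → False := by
      intro n
      induction n with
      | zero =>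
        intro _ PS TI I h
        rw [rootRec_zero] at h
        exact dfs_sound hK hF _ PS PL0 TI [] TD ⟨I.lenPS, I.lenPL, I.lenTI, I.psi, I.lines, fun t ht => I.feas t ht (Nat.zero_le _),
          fun t ht => I.adm t ht (Nat.zero_le _), fun x hx => absurd hx (List.not_mem_nil), hTD⟩ h
      | succ n ih =>
        intro hn PS TI I h
        rw [rootRec_succ] at h
        obtain ⟨PS', TI', e, I'⟩ := refresh_sound hF I (show n < K by omega)
          (fun PS' TI' => rootRec PL0 (fun PS TI => dfs K (Nat.add (lenL TD) 1) PS PL0 TI [] TD) n PS' TI')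
        rw [e] at h
        refine ih (Nat.le_of_succ_le hn) PS' TI' ⟨I'.lenPS, I'.lenPL, I'.lenTI, I'.psi, I'.lines,
          fun t ht hnt => I'.feas t ht ?_, fun t ht hnt => I'.adm t ht ?_⟩ h
        · rcases Nat.eq_or_lt_of_le hnt with h | h; exacts [Or.inr h.symm, Or.inl h]
        · rcases Nat.eq_or_lt_of_le hnt with h | h; exacts [Or.inr h.symm, Or.inl h]
    refine chain K le_rfl (8 :: zerosL (Nat.sub K 1)) (zerosL K) ⟨?_, lPL0, by simp, fun t ht => ?_, hlines0,
      fun t ht hKt => absurd hKt (Nat.not_le.2 ht), fun t ht hKt => absurd hKt (Nat.not_le.2 ht)⟩ hv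
    · simp; omega
    · rcases t with _ | t
      · right; rw [hψ0]; rfl
      · left; simp

end BSol

end IcosetW

end Summit.MatrixMultiplication.OmegaCensus
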